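import Mathlib
import HarnessLib
import Literature.Analysis.ODE.CompactSupportFlow

/-!
# Item `LrcModEntire` (stmt-NavierStokesRegularity-20428) — BRANCH-PARAM, part 1: the second-order «hot-branch ODE», its global flow and uniqueness

LEAD of item 20428 ns-poloidal-K2-p3 g15 (`--supports stmt-NavierStokesRegularity-20428 --as helper`).  Memo `Cruxes/LrcModEntire/T2B-g14.md` §13b/§14 and
port-2 g5's closing note (open point (ii) BRANCH-PARAM): every hull theorem of the (Q3∞)/(Q4) pipeline (`…RidgeHullValues.exists_hullLimit_crossSectionMax_const`,
`…RidgeWebFermat.web_fermat`) takes a COMPLETE unit-speed `C²` hot branch `γ : ℝ → P₀` as data.  This file and its two sequels (`…RidgeGlobalBranchLocal`,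
`…RidgeGlobalBranch`) CONSTRUCT it for a non-degenerate ridge (`κ > 0`), with no appeal to the classification of 1-manifolds or to Jordan separation: the
arclength parametrisation `(γ, γ′)` of a non-degenerate critical zero-curve of an analytic `f` solves the autonomous second-order system

  `ẏ = e`,  `ė = −κ⁻² · P D²f(y)[P ∇(D²f(·)(e,e))(y)]`   (`P` = horizontal projection, `κ = −Δₕ f` on the curve),

whose right-hand side, after clipping the speed (`e ↦ 2e/(1+‖e‖²)`, the identity on the unit sphere), is BOUNDED and GLOBALLY LIPSCHITZ on `E³ × E³` as soon as
`‖D²f‖, ‖D³f‖, ‖D⁴f‖` are bounded (KNSS slice bounds in the application) — so the tree's `Literature.Analysis.ODE.exists_solution_real_of_lipschitz_of_bound` gives a global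
solution through every initial condition, unique on every interval (`ODE_solution_unique_of_mem_Ioo`).  Class-free; pure calculus.

* `clip`, `clip_of_norm_eq_one`, `norm_clip_le_one`, `lipschitzWith_clip`;
* `branchField f κ : E³ × E³ → E³ × E³`, `norm_branchField_le`, `lipschitzWith_branchField`;
* `exists_global_solution` (a solution on all of `ℝ` through any point), `eqOn_of_solutions` (local uniqueness on an interval).

WHAT THIS IS NOT: not a claim about Navier–Stokes regularity — an ODE tool for the entrance of research cell (Q4) of the (TH) column of K2 (bears_on LADDER-NS N0, item
20428 / crux 19708; 20428/19708/27893 OPEN).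
-/

noncomputable section

-- the summit and its single sub-problem share the name (CONVENTIONS §1), as in every Theorems file
set_option linter.dupNamespace false

namespace Summit.NavierStokesRegularity.NavierStokesRegularity.Theorems.PoloidalWindowDoorLrcModEntireRidgeGlobalBranchODE

open Set Filter Topology Metric Function
open scoped NNReal InnerProductSpace RealInnerProductSpace

/-- The horizontal basis vector `e₀`. -/
def e0 : (EuclideanSpace ℝ (Fin 3)) := EuclideanSpace.single 0 1
/-- The horizontal basis vector `e₁`. -/
def e1 : (EuclideanSpace ℝ (Fin 3)) := EuclideanSpace.single 1 1

/-- Coordinates of `e₀`. -/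
@[simp] theorem e0_apply : e0 0 = 1 ∧ e0 1 = 0 ∧ e0 2 = 0 := by simp [e0]
/-- Coordinates of `e₁`. -/
@[simp] theorem e1_apply : e1 0 = 0 ∧ e1 1 = 1 ∧ e1 2 = 0 := by simp [e1]
/-- `‖e₀‖ = 1`. -/
@[simp] theorem norm_e0 : ‖e0‖ = 1 := by simp [e0]
/-- `‖e₁‖ = 1`. -/
@[simp] theorem norm_e1 : ‖e1‖ = 1 := by simp [e1]

/-! ### The speed clip `e ↦ 2e/(1+‖e‖²)` -/

/-- The speed clip: a bounded, globally Lipschitz map equal to the identity on the unit sphere. -/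
def clip (e : (EuclideanSpace ℝ (Fin 3))) : (EuclideanSpace ℝ (Fin 3)) := (2 / (1 + ‖e‖ ^ 2)) • e

/-- The clip is the identity on the unit sphere. -/
theorem clip_of_norm_eq_one {e : (EuclideanSpace ℝ (Fin 3))} (h : ‖e‖ = 1) : clip e = e := by
  simp [clip, h]; norm_num

/-- The clip takes values in the closed unit ball. -/
theorem norm_clip_le_one (e : (EuclideanSpace ℝ (Fin 3))) : ‖clip e‖ ≤ 1 := by
  have h1 : 0 < 1 + ‖e‖ ^ 2 := by positivity
  rw [clip, norm_smul, Real.norm_eq_abs, abs_of_pos (by positivity), div_mul_eq_mul_div, div_le_one h1]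
  nlinarith [sq_nonneg (‖e‖ - 1), norm_nonneg e]

/-- The clip is differentiable with `‖D clip‖ ≤ 3` everywhere. -/
theorem exists_hasFDerivAt_clip (e : (EuclideanSpace ℝ (Fin 3))) : ∃ L : (EuclideanSpace ℝ (Fin 3)) →L[ℝ] (EuclideanSpace ℝ (Fin 3)), HasFDerivAt clip L e ∧ ‖L‖ ≤ 3 := by
  have hsq := (hasStrictFDerivAt_norm_sq e).hasFDerivAt
  set S : (EuclideanSpace ℝ (Fin 3)) →L[ℝ] ℝ := 2 • innerSL ℝ e with hS
  have hSn : ‖S‖ ≤ 2 * ‖e‖ := by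
    rw [hS]; refine norm_nsmul_le.trans ?_; rw [innerSL_apply_norm]; norm_num
  have hc : 0 < 1 + ‖e‖ ^ 2 := by positivity
  have h1 : HasFDerivAt (fun x : (EuclideanSpace ℝ (Fin 3)) => 1 + ‖x‖ ^ 2) S e := hsq.const_add 1
  have hinv : HasFDerivAt (fun x : (EuclideanSpace ℝ (Fin 3)) => (1 + ‖x‖ ^ 2)⁻¹) ((-((1 + ‖e‖ ^ 2) ^ 2)⁻¹) • S) e :=
    (hasDerivAt_inv hc.ne').comp_hasFDerivAt e h1
  set D : (EuclideanSpace ℝ (Fin 3)) →L[ℝ] ℝ := (2 : ℝ) • ((-((1 + ‖e‖ ^ 2) ^ 2)⁻¹) • S) with hD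
  have hφ : HasFDerivAt (fun x : (EuclideanSpace ℝ (Fin 3)) => 2 / (1 + ‖x‖ ^ 2)) D e := by
    have h2 := hinv.const_mul (2 : ℝ)
    have heq : (fun x : (EuclideanSpace ℝ (Fin 3)) => 2 / (1 + ‖x‖ ^ 2)) = fun x => 2 * (1 + ‖x‖ ^ 2)⁻¹ := by
      funext x; rw [div_eq_mul_inv]
    rw [heq, hD]
    exact h2
  have h := hφ.smul (hasFDerivAt_id e)
  refine ⟨_, h, ?_⟩
  have hA : ‖(2 / (1 + ‖e‖ ^ 2)) • ContinuousLinearMap.id ℝ (EuclideanSpace ℝ (Fin 3))‖ ≤ 2 := by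
    rw [norm_smul, Real.norm_eq_abs, abs_of_pos (by positivity)]
    calc 2 / (1 + ‖e‖ ^ 2) * ‖ContinuousLinearMap.id ℝ (EuclideanSpace ℝ (Fin 3))‖ ≤ 2 / (1 + ‖e‖ ^ 2) * 1 :=
          mul_le_mul_of_nonneg_left ContinuousLinearMap.norm_id_le (by positivity)
      _ ≤ 2 := by rw [mul_one, div_le_iff₀ hc]; nlinarith [norm_nonneg e]
  have hDn : ‖D‖ ≤ 2 * (((1 + ‖e‖ ^ 2) ^ 2)⁻¹ * (2 * ‖e‖)) := by
    rw [hD, norm_smul, norm_smul, norm_neg, norm_inv, norm_pow, Real.norm_eq_abs, Real.norm_eq_abs, abs_of_pos hc,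
      abs_two]
    gcongr
  have hkey : 2 * (((1 + ‖e‖ ^ 2) ^ 2)⁻¹ * (2 * ‖e‖)) * ‖e‖ ≤ 1 := by
    rw [show 2 * (((1 + ‖e‖ ^ 2) ^ 2)⁻¹ * (2 * ‖e‖)) * ‖e‖ = 4 * ‖e‖ ^ 2 / (1 + ‖e‖ ^ 2) ^ 2 by ring]
    rw [div_le_one (by positivity)]
    nlinarith [sq_nonneg (‖e‖ ^ 2 - 1), norm_nonneg e]
  have hB : ‖D.smulRight (id e : EuclideanSpace ℝ (Fin 3))‖ ≤ 1 := by
    rw [ContinuousLinearMap.norm_smulRight_apply, id_eq]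
    calc ‖D‖ * ‖e‖ ≤ 2 * (((1 + ‖e‖ ^ 2) ^ 2)⁻¹ * (2 * ‖e‖)) * ‖e‖ := by gcongr
      _ ≤ 1 := hkey
  exact (norm_add_le _ _).trans (by linarith)

/-- The clip is globally `3`-Lipschitz. -/
theorem lipschitzWith_clip : LipschitzWith 3 clip := by
  refine lipschitzWith_of_nnnorm_fderiv_le (fun e => (exists_hasFDerivAt_clip e).choose_spec.1.differentiableAt) fun e => ?_
  obtain ⟨L, hL, hL3⟩ := exists_hasFDerivAt_clip e
  rw [hL.fderiv]
  exact_mod_cast hL3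

/-- The clip is globally `3`-Lipschitz (distance form). -/
theorem dist_clip_le (e e' : (EuclideanSpace ℝ (Fin 3))) : dist (clip e) (clip e') ≤ 3 * dist e e' := by
  have := lipschitzWith_clip.dist_le_mul e e'
  exact_mod_cast this

/-! ### The jet scalars and the field -/

/-- Second-jet scalar `D²f(y)[u, w]`. -/
def D2c (f : (EuclideanSpace ℝ (Fin 3)) → ℝ) (u w y : (EuclideanSpace ℝ (Fin 3))) : ℝ := iteratedFDeriv ℝ 2 f y ![u, w]

/-- Third-jet scalar along the clipped direction: `D³f(y)[u, clip e, clip e]`. -/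
def D3n (f : (EuclideanSpace ℝ (Fin 3)) → ℝ) (u y e : (EuclideanSpace ℝ (Fin 3))) : ℝ := iteratedFDeriv ℝ 3 f y ![u, clip e, clip e]

/-- The acceleration `−κ⁻² · P D²f(y)[P ∇(D²f(·)(e,e))]` (speed-clipped), written out in the horizontal frame `(e₀, e₁)`. -/
def accel (f : (EuclideanSpace ℝ (Fin 3)) → ℝ) (κ : ℝ) (p : (EuclideanSpace ℝ (Fin 3)) × (EuclideanSpace ℝ (Fin 3))) : (EuclideanSpace ℝ (Fin 3)) :=
  -(κ⁻¹ ^ 2) • ((D3n f e0 p.1 p.2 * D2c f e0 e0 p.1 + D3n f e1 p.1 p.2 * D2c f e1 e0 p.1) • e0 +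
    (D3n f e0 p.1 p.2 * D2c f e0 e1 p.1 + D3n f e1 p.1 p.2 * D2c f e1 e1 p.1) • e1)

/-- **The hot-branch field** on `E³ × E³`: `(y, e) ↦ (clip e, accel)`. -/
def branchField (f : (EuclideanSpace ℝ (Fin 3)) → ℝ) (κ : ℝ) (p : (EuclideanSpace ℝ (Fin 3)) × (EuclideanSpace ℝ (Fin 3))) : (EuclideanSpace ℝ (Fin 3)) × (EuclideanSpace ℝ (Fin 3)) := (clip p.2, accel f κ p)

/-- First component of the field. -/
@[simp] theorem branchField_fst (f : (EuclideanSpace ℝ (Fin 3)) → ℝ) (κ : ℝ) (p : (EuclideanSpace ℝ (Fin 3)) × (EuclideanSpace ℝ (Fin 3))) : (branchField f κ p).1 = clip p.2 := rfl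
/-- Second component of the field. -/
@[simp] theorem branchField_snd (f : (EuclideanSpace ℝ (Fin 3)) → ℝ) (κ : ℝ) (p : (EuclideanSpace ℝ (Fin 3)) × (EuclideanSpace ℝ (Fin 3))) : (branchField f κ p).2 = accel f κ p := rfl

/-! ### Bounds and Lipschitz estimates of the jet scalars -/

section estimates

variable {f : (EuclideanSpace ℝ (Fin 3)) → ℝ} {C₂ C₃ C₄ : ℝ}

/-- Sup-norm of a pair of vectors. -/
theorem norm_vec2_le {u w : (EuclideanSpace ℝ (Fin 3))} {r : ℝ} (hr : 0 ≤ r) (hu : ‖u‖ ≤ r) (hw : ‖w‖ ≤ r) : ‖(![u, w] : Fin 2 → (EuclideanSpace ℝ (Fin 3)))‖ ≤ r := by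
  rw [pi_norm_le_iff_of_nonneg hr]
  intro i; fin_cases i <;> simpa

/-- Sup-norm of a triple of vectors. -/
theorem norm_vec3_le {u w x : (EuclideanSpace ℝ (Fin 3))} {r : ℝ} (hr : 0 ≤ r) (hu : ‖u‖ ≤ r) (hw : ‖w‖ ≤ r) (hx : ‖x‖ ≤ r) :
    ‖(![u, w, x] : Fin 3 → (EuclideanSpace ℝ (Fin 3)))‖ ≤ r := by
  rw [pi_norm_le_iff_of_nonneg hr]
  intro i; fin_cases i <;> simpa

/-- The projections of `E³ × E³` are `1`-Lipschitz. -/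
theorem dist_fst_snd_le_dist (p q : (EuclideanSpace ℝ (Fin 3)) × (EuclideanSpace ℝ (Fin 3))) :
    dist p.1 q.1 ≤ dist p q ∧ dist p.2 q.2 ≤ dist p q := by
  rw [Prod.dist_eq]; exact ⟨le_max_left _ _, le_max_right _ _⟩

/-- `|D²f(y)[u,w]| ≤ C₂` for unit-bounded directions. -/
theorem abs_D2c_le (hC₂ : ∀ x, ‖iteratedFDeriv ℝ 2 f x‖ ≤ C₂) {u w : (EuclideanSpace ℝ (Fin 3))} (hu : ‖u‖ ≤ 1) (hw : ‖w‖ ≤ 1) (y : (EuclideanSpace ℝ (Fin 3))) :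
    |D2c f u w y| ≤ C₂ := by
  have h := (iteratedFDeriv ℝ 2 f y).le_opNorm ![u, w]
  rw [Fin.prod_univ_two] at h
  simp only [Matrix.cons_val_zero, Matrix.cons_val_one] at h
  have hC0 : 0 ≤ C₂ := (norm_nonneg _).trans (hC₂ y)
  rw [D2c, ← Real.norm_eq_abs]
  calc ‖iteratedFDeriv ℝ 2 f y ![u, w]‖ ≤ ‖iteratedFDeriv ℝ 2 f y‖ * (‖u‖ * ‖w‖) := h
    _ ≤ C₂ * (1 * 1) := mul_le_mul (hC₂ y) (mul_le_mul hu hw (norm_nonneg _) zero_le_one) (by positivity) hC0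
    _ = C₂ := by ring

/-- `|D³f(y)[u, clip e, clip e]| ≤ C₃` for a unit-bounded direction `u`. -/
theorem abs_D3n_le (hC₃ : ∀ x, ‖iteratedFDeriv ℝ 3 f x‖ ≤ C₃) {u : (EuclideanSpace ℝ (Fin 3))} (hu : ‖u‖ ≤ 1) (y e : (EuclideanSpace ℝ (Fin 3))) :
    |D3n f u y e| ≤ C₃ := by
  have h := (iteratedFDeriv ℝ 3 f y).le_opNorm ![u, clip e, clip e]
  rw [Fin.prod_univ_three] at h
  simp only [Matrix.cons_val_zero, Matrix.cons_val_one, Matrix.cons_val] at h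
  have hC0 : 0 ≤ C₃ := (norm_nonneg _).trans (hC₃ y)
  have hn := norm_clip_le_one e
  rw [D3n, ← Real.norm_eq_abs]
  calc ‖iteratedFDeriv ℝ 3 f y ![u, clip e, clip e]‖ ≤ ‖iteratedFDeriv ℝ 3 f y‖ * (‖u‖ * ‖clip e‖ * ‖clip e‖) := h
    _ ≤ C₃ * (1 * 1 * 1) := by
        refine mul_le_mul (hC₃ y) ?_ (by positivity) hC0
        exact mul_le_mul (mul_le_mul hu hn (norm_nonneg _) zero_le_one) hn (norm_nonneg _) (by positivity)
    _ = C₃ := by ring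

/-- `y ↦ Dᵏf(y)` is `C_{k+1}`-Lipschitz (mean value inequality). -/
theorem norm_iteratedFDeriv_sub_le {k : ℕ} (hf : ContDiff ℝ (k + 1) f) {C : ℝ} (hC : ∀ x, ‖iteratedFDeriv ℝ (k + 1) f x‖ ≤ C)
    (y y' : (EuclideanSpace ℝ (Fin 3))) : ‖iteratedFDeriv ℝ k f y - iteratedFDeriv ℝ k f y'‖ ≤ C * ‖y - y'‖ := by
  have hd : ∀ x, DifferentiableAt ℝ (iteratedFDeriv ℝ k f) x := fun x =>
    (hf.differentiable_iteratedFDeriv (by exact_mod_cast Nat.lt_succ_self k) : Differentiable ℝ (iteratedFDeriv ℝ k f)) x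
  exact (convex_univ).norm_image_sub_le_of_norm_fderiv_le (fun x _ => hd x)
    (fun x _ => by rw [norm_fderiv_iteratedFDeriv]; exact hC x) (mem_univ y') (mem_univ y)

/-- `y ↦ D²f(y)[u,w]` is `C₃`-Lipschitz for unit-bounded directions. -/
theorem dist_D2c_le (hf : ContDiff ℝ 3 f) (hC₃ : ∀ x, ‖iteratedFDeriv ℝ 3 f x‖ ≤ C₃) {u w : (EuclideanSpace ℝ (Fin 3))} (hu : ‖u‖ ≤ 1) (hw : ‖w‖ ≤ 1)
    (y y' : (EuclideanSpace ℝ (Fin 3))) : dist (D2c f u w y) (D2c f u w y') ≤ C₃ * dist y y' := by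
  rw [dist_eq_norm, dist_eq_norm, D2c, D2c, ← sub_apply]
  have hmv := norm_iteratedFDeriv_sub_le (k := 2) hf hC₃ y y'
  have h := (iteratedFDeriv ℝ 2 f y - iteratedFDeriv ℝ 2 f y').le_opNorm ![u, w]
  rw [Fin.prod_univ_two] at h
  simp only [Matrix.cons_val_zero, Matrix.cons_val_one] at h
  have hC0 : 0 ≤ C₃ := (norm_nonneg _).trans (hC₃ y)
  calc ‖(iteratedFDeriv ℝ 2 f y - iteratedFDeriv ℝ 2 f y') ![u, w]‖
      ≤ ‖iteratedFDeriv ℝ 2 f y - iteratedFDeriv ℝ 2 f y'‖ * (‖u‖ * ‖w‖) := h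
    _ ≤ C₃ * ‖y - y'‖ * (1 * 1) := mul_le_mul hmv (mul_le_mul hu hw (norm_nonneg _) zero_le_one) (by positivity) (by positivity)
    _ = C₃ * ‖y - y'‖ := by ring

/-- `(y,e) ↦ D³f(y)[u, clip e, clip e]` is Lipschitz: `≤ C₄·dist y y′ + 9C₃·dist e e′`. -/
theorem dist_D3n_le (hf : ContDiff ℝ 4 f) (hC₃ : ∀ x, ‖iteratedFDeriv ℝ 3 f x‖ ≤ C₃) (hC₄ : ∀ x, ‖iteratedFDeriv ℝ 4 f x‖ ≤ C₄)
    {u : (EuclideanSpace ℝ (Fin 3))} (hu : ‖u‖ ≤ 1) (y y' e e' : (EuclideanSpace ℝ (Fin 3))) :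
    dist (D3n f u y e) (D3n f u y' e') ≤ C₄ * dist y y' + 9 * C₃ * dist e e' := by
  have hC30 : 0 ≤ C₃ := (norm_nonneg _).trans (hC₃ y)
  have hC40 : 0 ≤ C₄ := (norm_nonneg _).trans (hC₄ y)
  -- split `D³f(y)[m] − D³f(y′)[m′] = (D³f(y) − D³f(y′))[m] + (D³f(y′)[m] − D³f(y′)[m′])`
  set m : Fin 3 → (EuclideanSpace ℝ (Fin 3)) := ![u, clip e, clip e] with hm
  set m' : Fin 3 → (EuclideanSpace ℝ (Fin 3)) := ![u, clip e', clip e'] with hm'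
  have hmn : ‖m‖ ≤ 1 := norm_vec3_le zero_le_one hu (norm_clip_le_one e) (norm_clip_le_one e)
  have hm'n : ‖m'‖ ≤ 1 := norm_vec3_le zero_le_one hu (norm_clip_le_one e') (norm_clip_le_one e')
  have hmm' : ‖m - m'‖ ≤ 3 * dist e e' := by
    have h3 : 0 ≤ 3 * dist e e' := by positivity
    have hsub : m - m' = ![0, clip e - clip e', clip e - clip e'] := by
      rw [hm, hm']; ext i j; fin_cases i <;> simp
    rw [hsub, pi_norm_le_iff_of_nonneg h3]
    have hc : ‖clip e - clip e'‖ ≤ 3 * dist e e' := by rw [← dist_eq_norm]; exact dist_clip_le e e'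
    intro i; fin_cases i
    · simp
    · simpa using hc
    · simpa using hc
  have hA : ‖(iteratedFDeriv ℝ 3 f y - iteratedFDeriv ℝ 3 f y') m‖ ≤ C₄ * dist y y' := by
    have h := (iteratedFDeriv ℝ 3 f y - iteratedFDeriv ℝ 3 f y').le_opNorm m
    have hmv := norm_iteratedFDeriv_sub_le (k := 3) hf hC₄ y y'
    have hprod : ∏ i, ‖m i‖ ≤ 1 := by
      rw [Fin.prod_univ_three]
      have h0 : ‖m 0‖ ≤ 1 := by simpa [hm] using hu
      have h1 : ‖m 1‖ ≤ 1 := by simpa [hm] using norm_clip_le_one e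
      have h2 : ‖m 2‖ ≤ 1 := by simpa [hm] using norm_clip_le_one e
      calc ‖m 0‖ * ‖m 1‖ * ‖m 2‖ ≤ 1 * 1 * 1 :=
            mul_le_mul (mul_le_mul h0 h1 (norm_nonneg _) zero_le_one) h2 (norm_nonneg _) (by positivity)
        _ = 1 := by ring
    calc ‖(iteratedFDeriv ℝ 3 f y - iteratedFDeriv ℝ 3 f y') m‖ ≤ ‖iteratedFDeriv ℝ 3 f y - iteratedFDeriv ℝ 3 f y'‖ * ∏ i, ‖m i‖ := h
      _ ≤ C₄ * ‖y - y'‖ * 1 := mul_le_mul hmv hprod (by positivity) (by positivity)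
      _ = C₄ * dist y y' := by rw [dist_eq_norm, mul_one]
  have hB : ‖iteratedFDeriv ℝ 3 f y' m - iteratedFDeriv ℝ 3 f y' m'‖ ≤ 9 * C₃ * dist e e' := by
    have h := (iteratedFDeriv ℝ 3 f y').norm_image_sub_le m m'
    have hcard : (Fintype.card (Fin 3) : ℝ) = 3 := by simp
    rw [hcard] at h
    have hmax : max ‖m‖ ‖m'‖ ≤ 1 := max_le hmn hm'n
    have hpow : max ‖m‖ ‖m'‖ ^ (Fintype.card (Fin 3) - 1) ≤ 1 := pow_le_one₀ (by positivity) hmax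
    calc ‖iteratedFDeriv ℝ 3 f y' m - iteratedFDeriv ℝ 3 f y' m'‖
        ≤ ‖iteratedFDeriv ℝ 3 f y'‖ * 3 * max ‖m‖ ‖m'‖ ^ (Fintype.card (Fin 3) - 1) * ‖m - m'‖ := h
      _ ≤ C₃ * 3 * 1 * (3 * dist e e') := by
          refine mul_le_mul (mul_le_mul (mul_le_mul_of_nonneg_right (hC₃ y') (by norm_num)) hpow (by positivity)
            (by positivity)) hmm' (norm_nonneg _) (by positivity)
      _ = 9 * C₃ * dist e e' := by ring
  rw [dist_eq_norm, D3n, D3n]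
  calc ‖iteratedFDeriv ℝ 3 f y m - iteratedFDeriv ℝ 3 f y' m'‖
      = ‖(iteratedFDeriv ℝ 3 f y - iteratedFDeriv ℝ 3 f y') m + (iteratedFDeriv ℝ 3 f y' m - iteratedFDeriv ℝ 3 f y' m')‖ := by
        congr 1; rw [sub_apply]; abel
    _ ≤ C₄ * dist y y' + 9 * C₃ * dist e e' := (norm_add_le _ _).trans (add_le_add hA hB)

/-- Products of bounded Lipschitz scalars: `|ab − a′b′| ≤ A|b − b′| + B|a − a′|` when `|a| ≤ A`, `|b′| ≤ B`. -/
theorem dist_mul_le {a a' b b' A B : ℝ} (ha : |a| ≤ A) (hb : |b'| ≤ B) :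
    dist (a * b) (a' * b') ≤ A * dist b b' + B * dist a a' := by
  rw [Real.dist_eq, Real.dist_eq, Real.dist_eq]
  have h : a * b - a' * b' = a * (b - b') + (a - a') * b' := by ring
  rw [h]
  refine (abs_add_le _ _).trans ?_
  rw [abs_mul, abs_mul]
  nlinarith [abs_nonneg (b - b'), abs_nonneg (a - a'), abs_nonneg a, abs_nonneg b']

/-- The four products `D3n · D2c` entering `accel` are uniformly Lipschitz on `E³ × E³` (sup distance). -/
theorem dist_prod_term_le (hf : ContDiff ℝ 4 f) (hC₂ : ∀ x, ‖iteratedFDeriv ℝ 2 f x‖ ≤ C₂)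
    (hC₃ : ∀ x, ‖iteratedFDeriv ℝ 3 f x‖ ≤ C₃) (hC₄ : ∀ x, ‖iteratedFDeriv ℝ 4 f x‖ ≤ C₄)
    {u u' w : (EuclideanSpace ℝ (Fin 3))} (hu : ‖u‖ ≤ 1) (hu' : ‖u'‖ ≤ 1) (hw : ‖w‖ ≤ 1) (p q : (EuclideanSpace ℝ (Fin 3)) × (EuclideanSpace ℝ (Fin 3))) :
    dist (D3n f u p.1 p.2 * D2c f u' w p.1) (D3n f u q.1 q.2 * D2c f u' w q.1) ≤
      (C₃ * C₃ + C₂ * (C₄ + 9 * C₃)) * dist p q := by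
  have hC20 : 0 ≤ C₂ := (norm_nonneg _).trans (hC₂ 0)
  have hC30 : 0 ≤ C₃ := (norm_nonneg _).trans (hC₃ 0)
  have hC40 : 0 ≤ C₄ := (norm_nonneg _).trans (hC₄ 0)
  have h1 : dist p.1 q.1 ≤ dist p q := (dist_fst_snd_le_dist p q).1
  have h2 : dist p.2 q.2 ≤ dist p q := (dist_fst_snd_le_dist p q).2
  have hm := dist_mul_le (abs_D3n_le hC₃ hu p.1 p.2) (abs_D2c_le hC₂ hu' hw q.1)
    (b := D2c f u' w p.1) (a' := D3n f u q.1 q.2)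
  have hd2 := dist_D2c_le (hf.of_le (by norm_cast)) hC₃ hu' hw p.1 q.1
  have hd3 := dist_D3n_le hf hC₃ hC₄ hu p.1 q.1 p.2 q.2
  calc dist (D3n f u p.1 p.2 * D2c f u' w p.1) (D3n f u q.1 q.2 * D2c f u' w q.1)
      ≤ C₃ * dist (D2c f u' w p.1) (D2c f u' w q.1) + C₂ * dist (D3n f u p.1 p.2) (D3n f u q.1 q.2) := hm
    _ ≤ C₃ * (C₃ * dist p q) + C₂ * (C₄ * dist p q + 9 * C₃ * dist p q) := by
        gcongr
        · exact hd2.trans (by gcongr)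
        · exact hd3.trans (by gcongr)
    _ = (C₃ * C₃ + C₂ * (C₄ + 9 * C₃)) * dist p q := by ring

end estimates

/-! ### The field is bounded and globally Lipschitz -/

section field

variable {f : (EuclideanSpace ℝ (Fin 3)) → ℝ} {κ C₂ C₃ C₄ : ℝ}

/-- The acceleration is bounded. -/
theorem norm_accel_le (hC₂ : ∀ x, ‖iteratedFDeriv ℝ 2 f x‖ ≤ C₂) (hC₃ : ∀ x, ‖iteratedFDeriv ℝ 3 f x‖ ≤ C₃) (p : (EuclideanSpace ℝ (Fin 3)) × (EuclideanSpace ℝ (Fin 3))) :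
    ‖accel f κ p‖ ≤ κ⁻¹ ^ 2 * (4 * (C₃ * C₂)) := by
  have hC20 : 0 ≤ C₂ := (norm_nonneg _).trans (hC₂ 0)
  have hC30 : 0 ≤ C₃ := (norm_nonneg _).trans (hC₃ 0)
  have ha0 := abs_D3n_le hC₃ (u := e0) (by simp) p.1 p.2
  have ha1 := abs_D3n_le hC₃ (u := e1) (by simp) p.1 p.2
  have hm00 := abs_D2c_le hC₂ (u := e0) (w := e0) (by simp) (by simp) p.1
  have hm10 := abs_D2c_le hC₂ (u := e1) (w := e0) (by simp) (by simp) p.1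
  have hm01 := abs_D2c_le hC₂ (u := e0) (w := e1) (by simp) (by simp) p.1
  have hm11 := abs_D2c_le hC₂ (u := e1) (w := e1) (by simp) (by simp) p.1
  have hprod : ∀ {a b : ℝ}, |a| ≤ C₃ → |b| ≤ C₂ → |a * b| ≤ C₃ * C₂ := fun ha hb => by
    rw [abs_mul]; exact mul_le_mul ha hb (abs_nonneg _) hC30
  rw [accel, norm_smul, norm_neg, Real.norm_eq_abs, abs_of_nonneg (by positivity)]
  refine mul_le_mul_of_nonneg_left ?_ (by positivity)
  refine (norm_add_le _ _).trans ?_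
  rw [norm_smul, norm_smul, norm_e0, norm_e1, mul_one, mul_one, Real.norm_eq_abs, Real.norm_eq_abs]
  have h1 := (abs_add_le _ _).trans (add_le_add (hprod ha0 hm00) (hprod ha1 hm10))
  have h2 := (abs_add_le _ _).trans (add_le_add (hprod ha0 hm01) (hprod ha1 hm11))
  linarith

/-- **The field is bounded.** -/
theorem norm_branchField_le (hC₂ : ∀ x, ‖iteratedFDeriv ℝ 2 f x‖ ≤ C₂) (hC₃ : ∀ x, ‖iteratedFDeriv ℝ 3 f x‖ ≤ C₃) (p : (EuclideanSpace ℝ (Fin 3)) × (EuclideanSpace ℝ (Fin 3))) :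
    ‖branchField f κ p‖ ≤ max 1 (κ⁻¹ ^ 2 * (4 * (C₃ * C₂))) := by
  rw [branchField, Prod.norm_def]
  exact max_le_max (norm_clip_le_one _) (norm_accel_le hC₂ hC₃ p)

/-- The acceleration is globally Lipschitz on `E³ × E³`. -/
theorem dist_accel_le (hf : ContDiff ℝ 4 f) (hC₂ : ∀ x, ‖iteratedFDeriv ℝ 2 f x‖ ≤ C₂)
    (hC₃ : ∀ x, ‖iteratedFDeriv ℝ 3 f x‖ ≤ C₃) (hC₄ : ∀ x, ‖iteratedFDeriv ℝ 4 f x‖ ≤ C₄) (p q : (EuclideanSpace ℝ (Fin 3)) × (EuclideanSpace ℝ (Fin 3))) :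
    dist (accel f κ p) (accel f κ q) ≤ κ⁻¹ ^ 2 * (4 * (C₃ * C₃ + C₂ * (C₄ + 9 * C₃))) * dist p q := by
  set L := C₃ * C₃ + C₂ * (C₄ + 9 * C₃) with hL
  have h00 := dist_prod_term_le hf hC₂ hC₃ hC₄ (u := e0) (u' := e0) (w := e0) (by simp) (by simp) (by simp) p q
  have h10 := dist_prod_term_le hf hC₂ hC₃ hC₄ (u := e1) (u' := e1) (w := e0) (by simp) (by simp) (by simp) p q
  have h01 := dist_prod_term_le hf hC₂ hC₃ hC₄ (u := e0) (u' := e0) (w := e1) (by simp) (by simp) (by simp) p q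
  have h11 := dist_prod_term_le hf hC₂ hC₃ hC₄ (u := e1) (u' := e1) (w := e1) (by simp) (by simp) (by simp) p q
  have hs0 := (dist_add_add_le _ _ _ _).trans (add_le_add h00 h10)
  have hs1 := (dist_add_add_le _ _ _ _).trans (add_le_add h01 h11)
  have hv0 : ∀ a b : ℝ, dist (a • e0) (b • e0) = dist a b := fun a b => by
    rw [dist_eq_norm, ← sub_smul, norm_smul, norm_e0, mul_one, dist_eq_norm]
  have hv1 : ∀ a b : ℝ, dist (a • e1) (b • e1) = dist a b := fun a b => by
    rw [dist_eq_norm, ← sub_smul, norm_smul, norm_e1, mul_one, dist_eq_norm]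
  rw [accel, accel, dist_smul₀, norm_neg, Real.norm_eq_abs, abs_of_nonneg (by positivity)]
  rw [mul_assoc]
  refine mul_le_mul_of_nonneg_left ?_ (by positivity)
  refine (dist_add_add_le _ _ _ _).trans ?_
  rw [hv0, hv1]
  linarith

/-- **The field is globally Lipschitz.** -/
theorem lipschitzWith_branchField (hf : ContDiff ℝ 4 f) (hC₂ : ∀ x, ‖iteratedFDeriv ℝ 2 f x‖ ≤ C₂)
    (hC₃ : ∀ x, ‖iteratedFDeriv ℝ 3 f x‖ ≤ C₃) (hC₄ : ∀ x, ‖iteratedFDeriv ℝ 4 f x‖ ≤ C₄) :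
    ∃ K : ℝ≥0, LipschitzWith K (branchField f κ) := by
  have hC20 : 0 ≤ C₂ := (norm_nonneg _).trans (hC₂ 0)
  have hC30 : 0 ≤ C₃ := (norm_nonneg _).trans (hC₃ 0)
  have hC40 : 0 ≤ C₄ := (norm_nonneg _).trans (hC₄ 0)
  set L : ℝ := max 3 (κ⁻¹ ^ 2 * (4 * (C₃ * C₃ + C₂ * (C₄ + 9 * C₃)))) with hL
  have hL0 : 0 ≤ L := le_max_of_le_left (by norm_num)
  refine ⟨Real.toNNReal L, LipschitzWith.of_dist_le_mul fun p q => ?_⟩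
  rw [Real.coe_toNNReal _ hL0, branchField, branchField, Prod.dist_eq]
  refine max_le ?_ ?_
  · calc dist (clip p.2) (clip q.2) ≤ 3 * dist p.2 q.2 := dist_clip_le _ _
      _ ≤ 3 * dist p q := by gcongr; exact (dist_fst_snd_le_dist p q).2
      _ ≤ L * dist p q := mul_le_mul_of_nonneg_right (le_max_left _ _) dist_nonneg
  · calc dist (accel f κ p) (accel f κ q) ≤ κ⁻¹ ^ 2 * (4 * (C₃ * C₃ + C₂ * (C₄ + 9 * C₃))) * dist p q :=
          dist_accel_le hf hC₂ hC₃ hC₄ p q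
      _ ≤ L * dist p q := mul_le_mul_of_nonneg_right (le_max_right _ _) dist_nonneg

/-- **Global solutions of the hot-branch ODE through every point.** -/
theorem exists_global_solution (hf : ContDiff ℝ 4 f) (hC₂ : ∀ x, ‖iteratedFDeriv ℝ 2 f x‖ ≤ C₂)
    (hC₃ : ∀ x, ‖iteratedFDeriv ℝ 3 f x‖ ≤ C₃) (hC₄ : ∀ x, ‖iteratedFDeriv ℝ 4 f x‖ ≤ C₄) (p₀ : (EuclideanSpace ℝ (Fin 3)) × (EuclideanSpace ℝ (Fin 3))) :
    ∃ Y : ℝ → (EuclideanSpace ℝ (Fin 3)) × (EuclideanSpace ℝ (Fin 3)), Y 0 = p₀ ∧ ∀ s, HasDerivAt Y (branchField f κ (Y s)) s := by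
  obtain ⟨K, hK⟩ := lipschitzWith_branchField (κ := κ) hf hC₂ hC₃ hC₄
  exact Literature.Analysis.ODE.exists_solution_real_of_lipschitz_of_bound hK (norm_branchField_le hC₂ hC₃) p₀

/-- **Uniqueness on an interval**: two solutions of the hot-branch ODE on `Ioo a b` that agree at `t₀ ∈ Ioo a b` agree on `Ioo a b`. -/
theorem eqOn_of_solutions (hf : ContDiff ℝ 4 f) (hC₂ : ∀ x, ‖iteratedFDeriv ℝ 2 f x‖ ≤ C₂)
    (hC₃ : ∀ x, ‖iteratedFDeriv ℝ 3 f x‖ ≤ C₃) (hC₄ : ∀ x, ‖iteratedFDeriv ℝ 4 f x‖ ≤ C₄)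
    {Y Z : ℝ → (EuclideanSpace ℝ (Fin 3)) × (EuclideanSpace ℝ (Fin 3))} {a b t₀ : ℝ} (ht₀ : t₀ ∈ Ioo a b)
    (hY : ∀ s ∈ Ioo a b, HasDerivAt Y (branchField f κ (Y s)) s) (hZ : ∀ s ∈ Ioo a b, HasDerivAt Z (branchField f κ (Z s)) s)
    (h0 : Y t₀ = Z t₀) : EqOn Y Z (Ioo a b) := by
  obtain ⟨K, hK⟩ := lipschitzWith_branchField (κ := κ) hf hC₂ hC₃ hC₄
  exact ODE_solution_unique_of_mem_Ioo (v := fun _ => branchField f κ) (s := fun _ => univ)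
    (fun _ _ => hK.lipschitzOnWith) ht₀ (fun s hs => ⟨hY s hs, mem_univ _⟩) (fun s hs => ⟨hZ s hs, mem_univ _⟩) h0

end field

end Summit.NavierStokesRegularity.NavierStokesRegularity.Theorems.PoloidalWindowDoorLrcModEntireRidgeGlobalBranchODE

end
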